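import Summits.BirchSwinnertonDyer.BirchSwinnertonDyer.Theses.TwistFamilyManinDescent
import HarnessLib

/-!
# Route `TwistFamilyManinDescent`, LINE 15 glue `RaynaudRegimeOfOrientation` (stmt-BirchSwinnertonDyer-27096):
# Ray57 ⟸ K15a `SupersingularStrongIsUnstarred` ∧ K15b `SupersingularUnstarredStrongManinUnit`

Cell `pub/bsd-wall`, seat `bsd-line-ttd-p1` (g6; TTD prover working the planner-of-record's TFMD lines).
THEOREM ONLY; closes the glue item BY NAME. Dispatch on the Raynaud-regime row predicate of Ray57
(`EisensteinRaynaudRegimeManinUnit`, stmt-26325): `(5; v₅ Δ_min ∈ {4, 8})` or `(7; v₇ Δ_min ∈ {3, 9})`; the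
STARRED rows `v = 8`, `v = 9` contradict K15a's bound `v_p Δ_min < 6` (the lattice-optimal = X₀(N)-optimal curve
is unstarred, stmt-27072), the UNSTARRED rows `v = 4`, `v = 3` are K15b (stmt-27071) verbatim. The planner's
`Sketch15.lean` argument. Nothing here proves BSD, Manin's conjecture, Ray57, K15a or K15b.
-/

set_option autoImplicit false
-- single-conjunct summit: `Summit.BirchSwinnertonDyer.BirchSwinnertonDyer.…` repeats the name by design
set_option linter.dupNamespace false

namespace Summit.BirchSwinnertonDyer.BirchSwinnertonDyer.Theorems.TwistFamilyManinDescent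

open Summit.BirchSwinnertonDyer.BirchSwinnertonDyer.Theses.TwistFamilyManinDescent

/-- **Glue `RaynaudRegimeOfOrientation` (stmt-BirchSwinnertonDyer-27096) BY NAME**: K15a (optimal ⇒ unstarred on
the Raynaud-regime rows) → K15b (Ray57 on the unstarred rows `(5; IV)`, `(7; III)`) → Ray57. Propositional
dispatch on `(p, v_p Δ_min)`: starred rows are emptied by K15a, unstarred rows are K15b.
[cite: EdixhovenManin1991, Thm. 3 and Prop. 7] -/
theorem raynaudRegimeOfOrientation_proof : RaynaudRegimeOfOrientation := by
  intro hA hB hM hAU hC hnf W _ _ N _ D p hp hrow hpN hred htw hopt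
  have h6 := hA W D p hp hrow hpN hred htw hopt
  rcases hrow with ⟨rfl, h5⟩ | ⟨rfl, h7⟩
  · simp only [Finset.mem_insert, Finset.mem_singleton] at h5
    rcases h5 with h5 | h5
    · exact hB hM hAU hC hnf W D 5 hp (Or.inl ⟨rfl, h5⟩) hpN hred htw hopt
    · omega
  · simp only [Finset.mem_insert, Finset.mem_singleton] at h7
    rcases h7 with h7 | h7
    · exact hB hM hAU hC hnf W D 7 hp (Or.inr ⟨rfl, h7⟩) hpN hred htw hopt
    · omega

end Summit.BirchSwinnertonDyer.BirchSwinnertonDyer.Theorems.TwistFamilyManinDescent
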